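import Summits.CriticalPhenomena.PercolationContinuityZ3.Theorems.Transplant.KNLevelsStepII
import Summits.CriticalPhenomena.PercolationContinuityZ3.Theorems.Transplant.PlanarSkeletonConcDefs
import HarnessLib

/-!
# L5.1 (generic design-(D) re-typing) — Kozma–Nitzan Lemma 10 over a `PlanarSkeletonConc`: the WINDOW GRAPH `winGraph G w₀ R`,
# its planar levels `B⟨j⟩ = Win w₀ (Icc (lo - j) (hi + j)) R`, the level axioms, Step II for window levels, and the transfer of
# window-local probabilities (SHEAR-SCOPE §3.1 row `tubeGraph ↦ winGraph`, §3.9 L5.1; src `BoxProdZ2TubeLevels.lean`)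

builds on p205010 (kernel theorem, internal audit signed; external expert review pending) — nothing in this file uses p205010.
Lane `prim-bschramm`, seat `prim-bschramm-p1` (gen 7; lead g3 17:59:48Z, p3-g4 18:03:22Z); helper file
(`--supports stmt-CriticalPhenomena-4575 --as helper`).

This is the constructor substitution of p3's `BoxProdZ2TubeLevels` (the `X □ ℤ²` instance: tube graph `tubeGraph X π` over a fibre
window `π`, levels `π ×ˢ Icc (lo - j) (hi + j)`) along the dictionary of SHEAR-SCOPE §3.1: the product window `B_X(w₀, R) × P` becomes the
coordinate-free window `Win w₀ P R = {g : d_G(w₀, g) ≤ R, φ g ∈ P}` of `PlanarSkeletonConcDefs`, and the tube graph becomes the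
**window graph** `winGraph G w₀ R` — the edges of `G` with BOTH endpoints in the graph ball `B_G(w₀, R)`, on the SAME vertex type `V`
(off-ball vertices isolated; p3-g4's shape request 18:03:22Z), so that the generic level machinery `KNLevelsDefs` / `KNLevelsLocality` /
`KNLevelsStepII` applies verbatim and `IsSubbox (winGraph G w₀ R) Wt p D` / `real_eq_of_determinedBy_window` port word for word.
What replaces the product's "fibre edges leaving `π` do not exist" is the skeleton's sup-norm Lipschitz bound `lip`: a window-graph edge
leaving a level moves `φ` by at most one in each coordinate, so the outer vertex boundary of `B⟨j⟩` lies in `B⟨j+1⟩` (`winLevel_nest`),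
and a vertex of `Win w₀ (Icc lo hi) R` whose skeleton coordinate is off the boundary layer of the planar box is never an inner-boundary
vertex of the window in the window graph (`not_mem_innerBoundary_win_of_mem_Icc` — amendment (A): exterior attachments of a subbox never
touch the window ends).  Contents:
* §1 `winGraph G w₀ R`: adjacency, `winGraph_le`, local finiteness, degrees `≤ Δ` (`degree_winGraph_le`; with (μ): `degree_winGraph_le_Δ`);
* §2 `winLevel Φ w₀ R lo hi j := Φ.Win w₀ (Icc (lo - j) (hi + j)) R`, `mem_outerBoundary_win_iff` / `mem_innerBoundary_win_iff` (structural),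
  the ℓ^∞ consequences of `lip`, the level axioms `winLevel_monotone`, `winLevel_nest`;
* §3 `winLData`, `lhyp_win` (the generic `KNLevels.LHyp`), **`stepII_win`** (Step II for window levels, degree bound `Φ.Δ`);
* §4 `real_eq_of_determinedBy_window`: an event determined by the pairs inside `B_G(w₀, R)` has the same probability under
  `bondPercolation (winGraph G w₀ R) p` and `bondPercolation G p`.

[cite: KozmaNitzan2024, §4 Lemma 10, pp. 17–18 (Steps I–II), p. 15 (B⟨R⟩), p. 17 (subbox) — the ℤ^d model] [cite: GrimmettPercolation1999, §7.2]
-/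

noncomputable section

open MeasureTheory ProbabilityTheory
open scoped ENNReal

namespace Summit.CriticalPhenomena.PercolationContinuityZ3.Theorems

namespace Transplant

namespace Skel

open Literature.Probability.Percolation Literature.Probability.LatticeModels SimpleGraph
open Literature.Barriers.CriticalPhenomena (graphBall graphBall_finite mem_graphBall_self graphBall_mono)
open KNLevels
open KozmaNitzan (wireSet_mono)
open scoped Classical

variable {V : Type} (G : SimpleGraph V)

/-! ## §1 The window graph over a graph ball -/

/-- **The window graph at depth `R` about the root `w₀`**: the edges of `G` both of whose endpoints lie in the graph ball `B_G(w₀, R)`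
(a subgraph on the same vertex type; vertices off the ball are isolated).  Generic twin of `BoxProdZ2.tubeGraph X π` (SHEAR-SCOPE §3.1).
[cite: KozmaNitzan2024, §4 p. 17 (subbox: the induced graph on D)] -/
def winGraph (w₀ : V) (R : ℕ) : SimpleGraph V where
  Adj u v := G.Adj u v ∧ u ∈ graphBall G w₀ R ∧ v ∈ graphBall G w₀ R
  symm := ⟨fun _ _ h => ⟨h.1.symm, h.2.2, h.2.1⟩⟩
  loopless := ⟨fun _ h => h.1.ne rfl⟩

/-- Adjacency in the window graph. [folklore] -/
theorem winGraph_adj {w₀ : V} {R : ℕ} {u v : V} :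
    (winGraph G w₀ R).Adj u v ↔ G.Adj u v ∧ u ∈ graphBall G w₀ R ∧ v ∈ graphBall G w₀ R := Iff.rfl

/-- The window graph is a subgraph of `G`. [folklore] -/
theorem winGraph_le (w₀ : V) (R : ℕ) : winGraph G w₀ R ≤ G := fun _ _ h => h.1

/-- Edges of the window graph are edges of `G`. [folklore] -/
theorem edgeSet_winGraph_subset (w₀ : V) (R : ℕ) : (winGraph G w₀ R).edgeSet ⊆ G.edgeSet :=
  SimpleGraph.edgeSet_mono (winGraph_le G w₀ R)

/-- Inside the ball the window graph is `G`. [folklore] -/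
theorem winGraph_adj_of_mem {w₀ : V} {R : ℕ} {u v : V} (hu : u ∈ graphBall G w₀ R) (hv : v ∈ graphBall G w₀ R) :
    (winGraph G w₀ R).Adj u v ↔ G.Adj u v :=
  ⟨fun h => h.1, fun h => ⟨h, hu, hv⟩⟩

/-- Vertices off the ball are isolated in the window graph. [folklore] -/
theorem not_winGraph_adj_of_not_mem {w₀ : V} {R : ℕ} {u : V} (hu : u ∉ graphBall G w₀ R) (v : V) :
    ¬ (winGraph G w₀ R).Adj u v := fun h => hu h.2.1

/-- The window graphs grow with the depth. [folklore] -/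
theorem winGraph_mono (w₀ : V) {R R' : ℕ} (h : R ≤ R') : winGraph G w₀ R ≤ winGraph G w₀ R' :=
  fun _ _ huv => ⟨huv.1, graphBall_mono G w₀ h huv.2.1, graphBall_mono G w₀ h huv.2.2⟩

variable [G.LocallyFinite]

/-- The window graph is locally finite (its neighbour sets are those of `G` cut down to the ball). [folklore] -/
instance winGraph_locallyFinite (w₀ : V) (R : ℕ) : (winGraph G w₀ R).LocallyFinite := fun v =>
  Fintype.ofFinset ((G.neighborFinset v).filter fun w => v ∈ graphBall G w₀ R ∧ w ∈ graphBall G w₀ R) fun w => by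
    simp only [Finset.mem_filter, SimpleGraph.mem_neighborFinset, SimpleGraph.mem_neighborSet, winGraph_adj]

/-- Degrees in the window graph are at most those in `G`. [folklore] -/
theorem degree_winGraph_le {Δ : ℕ} (hΔ : ∀ v, G.degree v ≤ Δ) (w₀ : V) (R : ℕ) (v : V) :
    (winGraph G w₀ R).degree v ≤ Δ :=
  (SimpleGraph.degree_le_of_le (winGraph_le G w₀ R)).trans (hΔ v)

variable {G}

/-- With the degree bound (μ) of a `PlanarSkeletonConc`: window-graph degrees are `≤ Φ.Δ`. [folklore] -/
theorem degree_winGraph_le_Δ (Φ : PlanarSkeletonConc G) (w₀ : V) (R : ℕ) (v : V) : (winGraph G w₀ R).degree v ≤ Φ.Δ :=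
  degree_winGraph_le G Φ.degree_le w₀ R v

/-! ## §2 The planar levels over the window -/

variable (Φ : PlanarSkeletonConc G)

/-- Windows lie in the ball. [folklore] -/
theorem Win_subset_graphBall (w₀ : V) (P : Finset (Site 2)) (R : ℕ) : ↑(Φ.Win w₀ P R) ⊆ graphBall G w₀ R :=
  fun _ hg => ((Φ.mem_Win).1 (Finset.mem_coe.1 hg)).1

/-- **The window levels** `B⟨j⟩ := Win w₀ (Icc (lo - j) (hi + j)) R`: KN's enlarged boxes in the plane, full depth `R` in the fibre.
Generic twin of `BoxProdZ2.tubeLevel π lo hi j = π ×ˢ Icc (lo - j) (hi + j)`. [cite: KozmaNitzan2024, §4 p. 15 (B⟨R⟩)] -/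
def winLevel (w₀ : V) (R : ℕ) (lo hi : Site 2) (j : ℕ) : Finset V :=
  Φ.Win w₀ (Finset.Icc (lo - (j : Site 2)) (hi + (j : Site 2))) R

/-- Membership in a window level. [folklore] -/
theorem mem_winLevel_iff {w₀ : V} {R : ℕ} {lo hi : Site 2} {j : ℕ} {v : V} :
    v ∈ winLevel Φ w₀ R lo hi j ↔ v ∈ graphBall G w₀ R ∧ Φ.φ v ∈ Finset.Icc (lo - (j : Site 2)) (hi + (j : Site 2)) := by
  rw [winLevel, Φ.mem_Win]

/-- Level `0` is the window over `Icc lo hi`. [folklore] -/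
theorem winLevel_zero (w₀ : V) (R : ℕ) (lo hi : Site 2) : winLevel Φ w₀ R lo hi 0 = Φ.Win w₀ (Finset.Icc lo hi) R := by
  simp [winLevel]

/-- Window levels lie in the ball. [folklore] -/
theorem winLevel_subset_graphBall (w₀ : V) (R : ℕ) (lo hi : Site 2) (j : ℕ) : ↑(winLevel Φ w₀ R lo hi j) ⊆ graphBall G w₀ R :=
  Win_subset_graphBall Φ w₀ _ R

/-- **Outer boundary of a window in the window graph** (structural form): `x ∈ ∂^{out} Win w₀ P R` iff `x` lies in the ball, `φ x ∉ P`,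
and `x` has a `G`-neighbour in the ball with skeleton coordinate in `P` (contacts are never off-ball vertices: those are isolated).
[cite: KozmaNitzan2024, §4 p. 15 (∂_ev B)] -/
theorem mem_outerBoundary_win_iff {w₀ : V} {R : ℕ} {P : Finset (Site 2)} {x : V} :
    x ∈ outerBoundary (winGraph G w₀ R) (Φ.Win w₀ P R) ↔
      x ∈ graphBall G w₀ R ∧ Φ.φ x ∉ P ∧ ∃ y, G.Adj x y ∧ y ∈ graphBall G w₀ R ∧ Φ.φ y ∈ P := by
  rw [mem_outerBoundary_iff]
  constructor
  · rintro ⟨hx, y, hy, hxy⟩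
    rw [Φ.mem_Win] at hy
    obtain ⟨hadj, hx1, hy1⟩ := (winGraph_adj G).1 hxy
    exact ⟨hx1, fun h => hx ((Φ.mem_Win).2 ⟨hx1, h⟩), y, hadj, hy1, hy.2⟩
  · rintro ⟨hx1, hxP, y, hxy, hy1, hyP⟩
    exact ⟨fun h => hxP ((Φ.mem_Win).1 h).2, y, (Φ.mem_Win).2 ⟨hy1, hyP⟩, (winGraph_adj G).2 ⟨hxy, hx1, hy1⟩⟩

/-- **Inner boundary of a window in the window graph** (structural form): `v ∈ ∂^{in} Win w₀ P R` iff `v ∈ Win w₀ P R` and `v` has a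
`G`-neighbour IN THE BALL whose skeleton coordinate is outside `P` (MACRO contacts only: the ends of the ball are invisible in the window
graph — amendment (A)). [cite: KozmaNitzan2024, §4 p. 17 (∂_iv D)] -/
theorem mem_innerBoundary_win_iff {w₀ : V} {R : ℕ} {P : Finset (Site 2)} {v : V} :
    v ∈ innerBoundary (winGraph G w₀ R) (Φ.Win w₀ P R) ↔
      (v ∈ graphBall G w₀ R ∧ Φ.φ v ∈ P) ∧ ∃ y, G.Adj v y ∧ y ∈ graphBall G w₀ R ∧ Φ.φ y ∉ P := by
  rw [mem_innerBoundary_iff, Φ.mem_Win]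
  constructor
  · rintro ⟨hv, y, hy, hvy⟩
    obtain ⟨hadj, -, hy1⟩ := (winGraph_adj G).1 hvy
    exact ⟨hv, y, hadj, hy1, fun h => hy ((Φ.mem_Win).2 ⟨hy1, h⟩)⟩
  · rintro ⟨hv, y, hvy, hy1, hyP⟩
    exact ⟨hv, y, fun h => hyP ((Φ.mem_Win).1 h).2, (winGraph_adj G).2 ⟨hvy, hv.1, hy1⟩⟩

/-- **The Lipschitz step**: along an edge of `G` the skeleton coordinate stays in the unit sup-norm neighbourhood, so a planar box grows by
one in each direction across an edge: `φ u ∈ Icc a b → G.Adj u v → φ v ∈ Icc (a - 1) (b + 1)`. [folklore] -/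
theorem φ_mem_Icc_enlarge_of_adj {a b : Site 2} {u v : V} (hu : Φ.φ u ∈ Finset.Icc a b) (huv : G.Adj u v) :
    Φ.φ v ∈ Finset.Icc (a - 1) (b + 1) := by
  rw [Finset.mem_Icc] at hu ⊢
  obtain ⟨ha, hb⟩ := hu
  constructor <;> intro i
  · have h1 := Φ.lip huv i
    have h2 := ha i
    rw [abs_le] at h1
    simp only [Pi.sub_apply, Pi.one_apply]
    linarith [h1.1, h1.2]
  · have h1 := Φ.lip huv i
    have h2 := hb i
    rw [abs_le] at h1
    simp only [Pi.add_apply, Pi.one_apply]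
    linarith [h1.1, h1.2]

/-- **Level axiom 1**: the window levels increase. [folklore] -/
theorem winLevel_monotone (w₀ : V) (R : ℕ) (lo hi : Site 2) : Monotone (winLevel Φ w₀ R lo hi) := by
  intro j j' h
  refine Φ.Win_mono (Finset.Icc_subset_Icc (fun i => ?_) (fun i => ?_)) le_rfl <;>
    simp only [Pi.sub_apply, Pi.add_apply, Pi.natCast_apply] <;> omega

/-- **Level axiom 2**: the outer boundary (in the window graph) of `B⟨j⟩` lies in `B⟨j+1⟩` — by the Lipschitz step, in place of the
product's "a tube edge leaving `π × Λ` is a planar edge". [cite: KozmaNitzan2024, §4 p. 15 (∂_ev B ⊆ B⟨1⟩)] -/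
theorem winLevel_nest (w₀ : V) (R : ℕ) (lo hi : Site 2) (j : ℕ) :
    outerBoundary (winGraph G w₀ R) (winLevel Φ w₀ R lo hi j) ⊆ winLevel Φ w₀ R lo hi (j + 1) := by
  intro x hx
  obtain ⟨hx1, -, y, hxy, -, hyP⟩ := (mem_outerBoundary_win_iff Φ).1 hx
  rw [mem_winLevel_iff]
  refine ⟨hx1, ?_⟩
  have h := φ_mem_Icc_enlarge_of_adj Φ hyP hxy.symm
  refine Finset.Icc_subset_Icc (fun i => ?_) (fun i => ?_) h <;>
    simp only [Pi.sub_apply, Pi.add_apply, Pi.natCast_apply, Pi.one_apply] <;> push_cast <;> omega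

/-- A contact vertex of level `j` (outer boundary in the window graph) lies in the planar ANNULUS `B⟨j+1⟩ ∖ B⟨j⟩` over the ball.
[cite: KozmaNitzan2024, §4 p. 15 (∂_ev B)] -/
theorem mem_sdiff_of_mem_outerBoundary_winLevel {w₀ : V} {R : ℕ} {lo hi : Site 2} {j : ℕ} {x : V}
    (hx : x ∈ outerBoundary (winGraph G w₀ R) (winLevel Φ w₀ R lo hi j)) :
    x ∈ winLevel Φ w₀ R lo hi (j + 1) \ winLevel Φ w₀ R lo hi j :=
  Finset.mem_sdiff.2 ⟨winLevel_nest Φ w₀ R lo hi j hx, (mem_outerBoundary_iff.1 hx).1⟩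

/-- The planar ANNULUS `B⟨j+1⟩ ∖ B⟨j⟩` over the ball, coordinate form (for the seed kits of L5.5). [folklore] -/
theorem mem_winLevel_succ_sdiff_iff {w₀ : V} {R : ℕ} {lo hi : Site 2} {j : ℕ} {x : V} :
    x ∈ winLevel Φ w₀ R lo hi (j + 1) \ winLevel Φ w₀ R lo hi j ↔
      x ∈ graphBall G w₀ R ∧ Φ.φ x ∈ Finset.Icc (lo - ((j + 1 : ℕ) : Site 2)) (hi + ((j + 1 : ℕ) : Site 2)) ∧
        Φ.φ x ∉ Finset.Icc (lo - (j : Site 2)) (hi + (j : Site 2)) := by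
  rw [Finset.mem_sdiff, mem_winLevel_iff, mem_winLevel_iff]
  tauto

/-- **Amendment (A), generic form**: a window vertex whose skeleton coordinate lies in the SHRUNK box `Icc (lo + 1) (hi - 1)` is not an
inner-boundary vertex of `Win w₀ (Icc lo hi) R` in the window graph (all its window-graph neighbours have `φ ∈ Icc lo hi` by the
Lipschitz step; the ends of the ball carry no window-graph edges). [cite: KozmaNitzan2024, §4 p. 17 (∂_iv D)] -/
theorem not_mem_innerBoundary_win_of_mem_Icc {w₀ : V} {R : ℕ} {lo hi : Site 2} {v : V}
    (hv : Φ.φ v ∈ Finset.Icc (lo + 1) (hi - 1)) : v ∉ innerBoundary (winGraph G w₀ R) (Φ.Win w₀ (Finset.Icc lo hi) R) := by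
  intro h
  obtain ⟨-, y, hvy, -, hyP⟩ := (mem_innerBoundary_win_iff Φ).1 h
  refine hyP ?_
  have h1 := φ_mem_Icc_enlarge_of_adj Φ hv hvy
  refine Finset.Icc_subset_Icc (fun i => ?_) (fun i => ?_) h1 <;>
    simp only [Pi.sub_apply, Pi.add_apply, Pi.one_apply] <;> omega

/-! ## §3 The level data, the hypotheses of Lemma 10, Step II for window levels -/

/-- **The level data in the window graph**: levels `winLevel Φ w₀ R lo hi`, source `o`, support `Sfin`.
[cite: KozmaNitzan2024, §4 Lemma 10 (p. 17)] -/
def winLData (w₀ : V) (R : ℕ) (lo hi : Site 2) (o : V) (Sfin : Finset V) : LData (winGraph G w₀ R) :=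
  ⟨winLevel Φ w₀ R lo hi, o, Sfin⟩

/-- The levels of `winLData`. [folklore] -/
@[simp] theorem winLData_X (w₀ : V) (R : ℕ) (lo hi : Site 2) (o : V) (Sfin : Finset V) :
    (winLData Φ w₀ R lo hi o Sfin).X = winLevel Φ w₀ R lo hi := rfl

/-- The source of `winLData`. [folklore] -/
@[simp] theorem winLData_o (w₀ : V) (R : ℕ) (lo hi : Site 2) (o : V) (Sfin : Finset V) :
    (winLData Φ w₀ R lo hi o Sfin).o = o := rfl

/-- The support of `winLData`. [folklore] -/
@[simp] theorem winLData_Sfin (w₀ : V) (R : ℕ) (lo hi : Site 2) (o : V) (Sfin : Finset V) :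
    (winLData Φ w₀ R lo hi o Sfin).Sfin = Sfin := rfl

/-- `{o ↔ B}` for the window data is `{o ↔ Win w₀ (Icc lo hi) R}`. [folklore] -/
theorem reachB_winLData (w₀ : V) (R : ℕ) (lo hi : Site 2) (o : V) (Sfin : Finset V) :
    (winLData Φ w₀ R lo hi o Sfin).reachB = ⋃ b ∈ Φ.Win w₀ (Finset.Icc lo hi) R, openConn o b := by
  rw [LData.reachB, winLData_X, winLevel_zero]; rfl

/-- **The hypotheses of Lemma 10 for window levels**: a subbox `D ⊇ B⟨Rl+1⟩` (in the window graph) of a finitely supported weighting at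
parameter `p` and a source `o ∈ Sfin \ D` give `KNLevels.LHyp`. [cite: KozmaNitzan2024, §4 Lemma 10 (p. 17)] -/
theorem lhyp_win (w₀ : V) (R : ℕ) (lo hi : Site 2) {o : V} {Sfin D : Finset V} {Wt : Sym2 V → unitInterval} {p : unitInterval}
    {Rl : ℕ} (hsub : IsSubbox (winGraph G w₀ R) Wt p D) (hfin : FinSupp Wt Sfin) (hDS : D ⊆ Sfin)
    (hencl : winLevel Φ w₀ R lo hi (Rl + 1) ⊆ D) (ho : o ∉ D) (hoS : o ∈ Sfin) :
    LHyp (winLData Φ w₀ R lo hi o Sfin) Wt p D Rl where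
  mono := winLevel_monotone Φ w₀ R lo hi
  nest := winLevel_nest Φ w₀ R lo hi
  sub := hsub
  fin := hfin
  DS := hDS
  encl := hencl
  o_not := ho
  o_mem := hoS

/-- **Kozma–Nitzan's Step II over the window levels of a `PlanarSkeletonConc`** (degrees `≤ Φ.Δ`, countably many vertices): for a
finitely supported weighting `Wt` with a subbox `D ⊇ B⟨Rl+1⟩` in the window graph at depth `R` about `w₀`, at parameter `p < 1`, and a
source `o ∈ Sfin \ D`, if `P_Wt(o ↔ Win w₀ (Icc lo hi) R) > 1 - δ` and the level range `[j₀, j₁]`, `j₁ ≤ Rl`, has at least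
`(1-p)^{-Δ N}/δ` levels, then at some level `j` there are at least `N` (macro) contact vertices joined to `o` outside `B⟨j⟩` with
probability `> 1 - 2δ`.  Generic twin of `BoxProdZ2.stepII_tube`. [cite: KozmaNitzan2024, §4 p. 18 (Step II)] -/
theorem stepII_win [Countable V] (w₀ : V) (R : ℕ) (lo hi : Site 2) {o : V} {Sfin D : Finset V}
    {Wt : Sym2 V → unitInterval} {p : unitInterval} {Rl : ℕ}
    (hsub : IsSubbox (winGraph G w₀ R) Wt p D) (hfin : FinSupp Wt Sfin) (hDS : D ⊆ Sfin)
    (hencl : winLevel Φ w₀ R lo hi (Rl + 1) ⊆ D) (ho : o ∉ D) (hoS : o ∈ Sfin)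
    (hp1 : (p : ℝ) < 1) {N j₀ j₁ : ℕ} (hj₁ : j₁ ≤ Rl) {δ : ℝ}
    (hJ : 1 / (1 - (p : ℝ)) ^ (Φ.Δ * N) ≤ δ * ((Finset.Icc j₀ j₁).card : ℝ))
    (hreach : 1 - δ < (prodBernoulli Wt).real (⋃ b ∈ Φ.Win w₀ (Finset.Icc lo hi) R, openConn o b)) :
    ∃ j ∈ Finset.Icc j₀ j₁, 1 - 2 * δ < (prodBernoulli Wt).real {ω | N ≤ ((winLData Φ w₀ R lo hi o Sfin).Kont j ω).card} := by
  have hL := lhyp_win Φ w₀ R lo hi hsub hfin hDS hencl ho hoS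
  rw [← reachB_winLData Φ w₀ R lo hi o Sfin] at hreach
  exact hL.stepII (degree_winGraph_le_Δ Φ w₀ R) hp1 hj₁ hJ hreach

/-! ## §4 Transfer of window-local probabilities between the window graph and `G` -/

omit [G.LocallyFinite] in
/-- On the off-diagonal pairs inside the ball the graph weightings of the window graph and of `G` agree. [folklore] -/
theorem lattW_winGraph_eq {w₀ : V} {R : ℕ} (p : unitInterval) {e : Sym2 V} (he : e ∈ wireSet (graphBall G w₀ R)) :
    lattW (winGraph G w₀ R) p e = lattW G p e := by
  induction e using Sym2.ind with
  | h u v =>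
    obtain ⟨hu, hv, -⟩ := mk_mem_wireSet_iff.1 he
    by_cases h : G.Adj u v
    · rw [lattW_mk_of_adj _ p h, lattW_mk_of_adj _ p ((winGraph_adj G).2 ⟨h, hu, hv⟩)]
    · rw [lattW_mk_of_not_adj _ p h, lattW_mk_of_not_adj _ p (fun h' => h ((winGraph_adj G).1 h').1)]

omit [G.LocallyFinite] in
/-- **Transfer**: an event determined by the pairs inside the ball `B_G(w₀, R)` has the same probability under bond percolation on the
window graph and on `G` (so uniqueness-zone / linked-face / hittability inputs proved for `G` serve the window graph).  Generic twin of
`BoxProdZ2.real_eq_of_determinedBy_window`. [cite: KozmaNitzan2024, §4 p. 17 ("the induced graph on D is isomorphic to …")] -/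
theorem real_eq_of_determinedBy_window {w₀ : V} {R : ℕ} (p : unitInterval) {A : Set (BondConfig V)}
    (hA : DeterminedBy A (wireSet (graphBall G w₀ R))) (hAm : MeasurableSet A) :
    (bondPercolation (winGraph G w₀ R) p).real A = (bondPercolation G p).real A := by
  rw [← prodBernoulli_lattW, ← prodBernoulli_lattW]
  exact prodBernoulli_real_eq_of_determinedBy _ _ (fun e he => lattW_winGraph_eq p he) hA hAm

/-- Window form of the transfer: an event determined by the pairs inside a window `Win w₀ P R` has the same probability under the
window graph and under `G`. [folklore] -/
theorem real_eq_of_determinedBy_Win {w₀ : V} {R : ℕ} {P : Finset (Site 2)} (p : unitInterval) {A : Set (BondConfig V)}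
    (hA : DeterminedBy A (wireSet (↑(Φ.Win w₀ P R) : Set V))) (hAm : MeasurableSet A) :
    (bondPercolation (winGraph G w₀ R) p).real A = (bondPercolation G p).real A :=
  real_eq_of_determinedBy_window p (hA.mono (wireSet_mono (Win_subset_graphBall Φ w₀ P R))) hAm

end Skel

end Transplant

end Summit.CriticalPhenomena.PercolationContinuityZ3.Theorems

end
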